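import Summits.CriticalPhenomena.PercolationContinuityZ3.Theorems.PercNearOneGluingNoHeavyLowerTailSahiCombTriWCertGen
import Summits.CriticalPhenomena.PercolationContinuityZ3.Theorems.PercNearOneGluingNoHeavyLowerTailSahiCombTranslateRank

/-!
# CERT-GEN(q): the three BOUNDARY FAMILIES of the typed conjecture `CertGenKernel` are theorems — `X = ⊤`, `Y = ⊤`, `t = ⊤` (every `q`)

Support file of the one-cut programme (crux `NoHeavyLowerTail`, stmt-CriticalPhenomena-4575; cell `prim-masterthm`, seat P5 gen 19;
memo `FROM-prim-masterthm-p5-g19-QZETA-CHANNELS.md` §1).  `FiveUpSet.CertGenKernelAt X Y t q` (`…SahiCombTriWCertGen`) is the kernel-triviality of the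
two-copy q-zeta certificate for the up-sets `X, Y` and the translate `t`; the conjecture `CertGenKernel` asks it for some `q` on every configuration.
Here we prove it — for EVERY `q` — on the three boundary families where the staircase `D₂ –B– D₁ –A– D₃ –E` decouples into a triangular
elimination:

* `X = univ`:  `(E)` on `transl t Y` with `c` supported on `refl Y` is the translate-rank lemma (`eq_zero_of_zeta_sum_eq_zero_transl`), then `(A)` on `Y`
  with `a` supported IN `Y` is unitriangular, then `(B)` is C1 for `Y`                                                   — `certGenKernelAt_univ_left`;
* `Y = univ`:  `(E)` on `refl X` with `c` supported in `refl X` is unitriangular, `(A)` is C1 for `X`, `(B)` on `X` with `b` supported in `X`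
  is unitriangular                                                                                                          — `certGenKernelAt_univ_right`;
* `t = univ`:  `E = refl X ∩ refl Y ⊇ supp c` is unitriangular, then `(A)` and `(B)` are the two Kleitman-pair blocks C2′
  (`eq_zero_of_zeta_sum_eq_zero_inter`)                                                                                     — `certGenKernelAt_transl_univ`.
Tools proved here in function language: `eq_zero_of_zeta_sum_eq_zero_of_support` (a zeta relation holding on a family that CONTAINS the support
forces zero — minimal-cardinality argument, no up/down-set hypothesis) and `eq_zero_of_zeta_sum_eq_zero_inter` (C2′: support in `refl X ∩ Y`,
relations on `X ∩ Y`).  These are the first kernel-verified instances of the `CertGenKernelAt` predicate; the interior (`X, Y ≠ ⊤`, `t ≠ ⊤`) stays OPEN.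
HONEST LABEL: elementary, all proved (std axioms). [this work]
-/

namespace Summit.CriticalPhenomena.PercolationContinuityZ3.Theorems

namespace FiveUpSet

open Finset

variable {α : Type} [DecidableEq α] [Fintype α]

/-! ### Two plain elimination tools in function language -/

omit [Fintype α] in
/-- A finite zeta relation on a family containing the support forces zero: if `f d ≠ 0 → d ∈ U` and `Σ_d f d [d ⊆ u] = 0` for every
`u ∈ U` (sum over any finset `S ⊇ supp f`), then `f = 0`.  Proof: at a support point `u` of minimal cardinality the relation reads `f u = 0`.
(No up-set or down-set hypothesis: the relation at `u` only involves `d ⊆ u`.) [this work] -/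
theorem eq_zero_of_zeta_sum_eq_zero_of_support_aux (S : Finset (Finset α)) (U : Finset (Finset α)) (f : Finset α → ℚ)
    (hS : ∀ d, f d ≠ 0 → d ∈ S) (hf : ∀ d, f d ≠ 0 → d ∈ U)
    (h : ∀ u ∈ U, ∑ d ∈ S, f d * (if d ⊆ u then (1 : ℚ) else 0) = 0) : ∀ d, f d = 0 := by
  by_contra hne
  push Not at hne
  -- the support is a non-empty finset; take an element of minimal cardinality
  set T := S.filter (fun d => f d ≠ 0) with hT
  have hTne : T.Nonempty := by
    obtain ⟨d, hd⟩ := hne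
    exact ⟨d, mem_filter.2 ⟨hS d hd, hd⟩⟩
  obtain ⟨u, huT, humin⟩ := exists_min_image T (fun d => d.card) hTne
  have hfu : f u ≠ 0 := (mem_filter.1 huT).2
  have huU : u ∈ U := hf u hfu
  have hsum := h u huU
  rw [Finset.sum_eq_single u] at hsum
  · simp only [Finset.Subset.refl, if_true, mul_one] at hsum
    exact hfu hsum
  · intro d hdS hdu
    by_cases hsub : d ⊆ u
    · -- a proper subset of `u` in the support would have smaller cardinality
      have hlt : d.card < u.card := card_lt_card (lt_of_le_of_ne hsub hdu)
      by_cases hfd : f d = 0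
      · rw [hfd, zero_mul]
      · exact absurd (humin d (mem_filter.2 ⟨hdS, hfd⟩)) (not_le.2 hlt)
    · rw [if_neg hsub, mul_zero]
  · intro huS
    exact absurd (hS u hfu) huS

/-- A zeta relation `Σ_d f d [d ⊆ u] = 0` for all `u` in a family `U` containing the support of `f` forces `f = 0`. [this work] -/
theorem eq_zero_of_zeta_sum_eq_zero_of_support (U : Finset (Finset α)) (f : Finset α → ℚ) (hf : ∀ d, f d ≠ 0 → d ∈ U)
    (h : ∀ u ∈ U, ∑ d, f d * (if d ⊆ u then (1 : ℚ) else 0) = 0) : ∀ d, f d = 0 :=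
  eq_zero_of_zeta_sum_eq_zero_of_support_aux univ U f (fun d _ => mem_univ d) hf (fun u hu => h u hu)

/-- **C2′ in function language (the Kleitman-pair block).**  For up-sets `X, Y`: if `a` is supported on `refl X ∩ Y` and
`Σ_d a d [d ⊆ u] = 0` for all `u ∈ X ∩ Y`, then `a = 0`.  The relation extends from `X ∩ Y` to `X` (a support point `d ∈ Y` below `u` puts
`u` in `Y`), and then C1 for `X` applies. [this work] -/
theorem eq_zero_of_zeta_sum_eq_zero_inter (X Y : Finset (Finset α)) (hX : IsUpperSet (X : Set (Finset α)))
    (hY : IsUpperSet (Y : Set (Finset α))) (a : Finset α → ℚ) (ha : ∀ d, a d ≠ 0 → d ∈ refl X ∩ Y)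
    (h : ∀ u, u ∈ X ∩ Y → ∑ d, a d * (if d ⊆ u then (1 : ℚ) else 0) = 0) : ∀ d, a d = 0 := by
  refine eq_zero_of_zeta_sum_eq_zero hX a (fun d hd => mem_refl.1 (mem_inter.1 (ha d hd)).1) ?_
  intro t ht
  by_cases hty : t ∈ Y
  · exact h t (mem_inter.2 ⟨ht, hty⟩)
  · refine Finset.sum_eq_zero fun d _ => ?_
    by_cases had : a d = 0
    · rw [had, zero_mul]
    · have hdY : d ∈ Y := (mem_inter.1 (ha d had)).2
      have hdt : ¬ d ⊆ t := fun hsub => hty (hY hsub hdY)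
      rw [if_neg hdt, mul_zero]

/-! ### The boundary family `X = ⊤` -/

/-- **`CertGenKernelAt univ Y t q` for every up-set `Y`, every `t` and every `q`.**  With `X = ⊤`: `D₁ = Y`, `D₂ = D₃ = refl Y`, `W = Y`,
`E = transl t Y`; `(E)` kills `c` by the translate-rank lemma, then `(A)` is a zeta relation on `Y` for `a` supported in `Y`, then `(B)` is C1 for `Y`.
[this work] -/
theorem certGenKernelAt_univ_left (Y : Finset (Finset α)) (hY : IsUpperSet (Y : Set (Finset α))) (t : Finset α) (q : ℚ) :
    CertGenKernelAt (univ : Finset (Finset α)) Y t q := by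
  intro a b c ha hb hc hA hB hE
  -- (E): c = 0 by the translate-rank lemma on `transl t Y`
  have hc0 : ∀ d, c d = 0 := by
    refine eq_zero_of_zeta_sum_eq_zero_transl hY t c (fun d hd => ?_) (fun u hu => ?_)
    · have := mem_refl.1 (hc d hd)
      exact (mem_inter.1 this).2
    · exact hE u (mem_inter.2 ⟨mem_refl.2 (mem_univ _), hu⟩)
  -- (A): a = 0, a zeta relation on `Y` with `a` supported in `Y`
  have ha0 : ∀ d, a d = 0 := by
    refine eq_zero_of_zeta_sum_eq_zero_of_support Y a (fun d hd => (mem_inter.1 (ha d hd)).2) (fun u hu => ?_)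
    have h1 := hA u (mem_inter.2 ⟨mem_univ _, hu⟩)
    have h2 : ∑ d, c d * qzeta q d u = 0 := Finset.sum_eq_zero fun d _ => by rw [hc0 d, zero_mul]
    rw [h2, add_zero] at h1
    exact h1
  -- (B): b = 0 by C1 for `Y`
  have hb0 : ∀ d, b d = 0 := by
    refine eq_zero_of_zeta_sum_eq_zero hY b (fun d hd => mem_refl.1 (mem_inter.1 (hb d hd)).2) (fun u hu => ?_)
    have h1 := hB u (mem_inter.2 ⟨mem_univ _, hu⟩)
    have h2 : ∑ d, a d * qzeta q d u = 0 := Finset.sum_eq_zero fun d _ => by rw [ha0 d, zero_mul]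
    rw [h2, zero_add] at h1
    exact h1
  exact ⟨ha0, hb0, hc0⟩

/-! ### The boundary family `Y = ⊤` -/

/-- **`CertGenKernelAt X univ t q` for every up-set `X`, every `t` and every `q`.**  With `Y = ⊤`: `D₁ = D₃ = refl X`, `D₂ = W = X`,
`E = refl X`; `(E)` is a zeta relation on `refl X ⊇ supp c`, `(A)` is C1 for `X`, `(B)` a zeta relation on `X ⊇ supp b`. [this work] -/
theorem certGenKernelAt_univ_right (X : Finset (Finset α)) (hX : IsUpperSet (X : Set (Finset α))) (t : Finset α) (q : ℚ) :
    CertGenKernelAt X (univ : Finset (Finset α)) t q := by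
  intro a b c ha hb hc hA hB hE
  -- (E): c = 0 (relations on `refl X`, support in `refl X`)
  have hc0 : ∀ d, c d = 0 := by
    refine eq_zero_of_zeta_sum_eq_zero_of_support (refl X) c (fun d hd => ?_) (fun u hu => ?_)
    · have := hc d hd
      rw [inter_univ] at this
      exact this
    · exact hE u (mem_inter.2 ⟨hu, mem_transl.2 (mem_univ _)⟩)
  -- (A): a = 0 by C1 for `X`
  have ha0 : ∀ d, a d = 0 := by
    refine eq_zero_of_zeta_sum_eq_zero hX a (fun d hd => mem_refl.1 (mem_inter.1 (ha d hd)).1) (fun u hu => ?_)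
    have h1 := hA u (mem_inter.2 ⟨hu, mem_univ _⟩)
    have h2 : ∑ d, c d * qzeta q d u = 0 := Finset.sum_eq_zero fun d _ => by rw [hc0 d, zero_mul]
    rw [h2, add_zero] at h1
    exact h1
  -- (B): b = 0 (relations on `X`, support in `X`)
  have hb0 : ∀ d, b d = 0 := by
    refine eq_zero_of_zeta_sum_eq_zero_of_support X b (fun d hd => (mem_inter.1 (hb d hd)).1) (fun u hu => ?_)
    have h1 := hB u (mem_inter.2 ⟨hu, mem_univ _⟩)
    have h2 : ∑ d, a d * qzeta q d u = 0 := Finset.sum_eq_zero fun d _ => by rw [ha0 d, zero_mul]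
    rw [h2, zero_add] at h1
    exact h1
  exact ⟨ha0, hb0, hc0⟩

/-! ### The boundary family `t = ⊤` (full flip: `E = refl (X ∩ Y)`) -/

/-- **`CertGenKernelAt X Y univ q` for all up-sets `X, Y` and every `q`.**  With `t = ⊤`: `E = refl X ∩ refl Y = refl (X ∩ Y) ⊇ supp c`, so `(E)`
kills `c`; then `(A)` and `(B)` are the two Kleitman-pair blocks (`eq_zero_of_zeta_sum_eq_zero_inter` for `(X,Y)` and for `(Y,X)`).
(The inequality behind this configuration is the sum of two Kleitman inequalities; the certificate is block-triangular.) [this work] -/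
theorem certGenKernelAt_transl_univ (X Y : Finset (Finset α)) (hX : IsUpperSet (X : Set (Finset α)))
    (hY : IsUpperSet (Y : Set (Finset α))) (q : ℚ) : CertGenKernelAt X Y (univ : Finset α) q := by
  intro a b c ha hb hc hA hB hE
  -- (E): c = 0 (relations on `refl X ∩ refl Y`, which contains the support `refl (X ∩ Y)`)
  have hc0 : ∀ d, c d = 0 := by
    refine eq_zero_of_zeta_sum_eq_zero_of_support (refl X ∩ transl univ Y) c (fun d hd => ?_) (fun u hu => hE u hu)
    have := hc d hd
    rw [refl_inter] at this
    rw [transl_univ]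
    exact this
  -- (A): a = 0 by C2′ for `(X, Y)`
  have ha0 : ∀ d, a d = 0 := by
    refine eq_zero_of_zeta_sum_eq_zero_inter X Y hX hY a ha (fun u hu => ?_)
    have h1 := hA u hu
    have h2 : ∑ d, c d * qzeta q d u = 0 := Finset.sum_eq_zero fun d _ => by rw [hc0 d, zero_mul]
    rw [h2, add_zero] at h1
    exact h1
  -- (B): b = 0 by C2′ for `(Y, X)`
  have hb0 : ∀ d, b d = 0 := by
    refine eq_zero_of_zeta_sum_eq_zero_inter Y X hY hX b (fun d hd => ?_) (fun u hu => ?_)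
    · have := mem_inter.1 (hb d hd)
      exact mem_inter.2 ⟨this.2, this.1⟩
    · have hu' : u ∈ X ∩ Y := by rw [inter_comm]; exact hu
      have h1 := hB u hu'
      have h2 : ∑ d, a d * qzeta q d u = 0 := Finset.sum_eq_zero fun d _ => by rw [ha0 d, zero_mul]
      rw [h2, zero_add] at h1
      exact h1
  exact ⟨ha0, hb0, hc0⟩

end FiveUpSet

end Summit.CriticalPhenomena.PercolationContinuityZ3.Theorems
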